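import Literature.NumberTheory.EllipticCurves.LevelLoweringGamma0AtThreeSquarefree
import Literature.NumberTheory.DiophantineGeometry.TateAlgorithm
import HarnessLib

/-!
# Level lowering at any squarefree set of unramified multiplicative primes, in `Γ₀(N(ρ̄)·3^δ)`-newform
# currency, at `p = 3`, for a conductor WITH ADDITIVE PRIMES (Ribet 1990 / Diamond 1995 Thm. 6.4 –
# Cor. 6.5 / Darmon–Diamond–Taylor Thm. 3.15 + Lemma 2.7 + Carayol; non-semistable case)

Topic `NumberTheory/EllipticCurves`; namespace `Literature.NumberTheory.EllipticCurves`. ONE named fact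
(`def … : Prop`, nothing asserted, nothing admitted) + its `Iff.rfl` unfolding lemma. This is the sibling
of the tree's level-lowering facts at `p = 3` in `Γ₀`-newform currency — `ribet1990_levelLowering_gamma0_newform_at_three`
(ONE unramified multiplicative prime, module `LevelLoweringGamma0AtThree`), `…_prime_three`, `…_two_primes` and
`…_squarefree` (ANY squarefree set of removed primes, SEMISTABLE curve, module
`LevelLoweringGamma0AtThreeSquarefree`) — for a curve whose conductor `N` is NOT square-free: the removed primes
`D` are still a squarefree set of multiplicative primes at which `ρ̄ = ρ̄_{E,3}` is unramified (resp. finite at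
`3`), but the kept level `M₀ = N/D` may contain ADDITIVE primes `p² ∣ M₀` (`p ≠ 3`: the curve is not additive
at `3`, `9 ∤ N`). The one new clause is the condition at the additive primes under which the optimal level
`N(ρ̄)·3^{δ(ρ̄)}` keeps the FULL additive part of `N`, so that again `N(ρ̄)·3^δ = M₀`: «`3 ∤ #Φ_p(𝔽̄_p)`»
(the geometric component group of the Néron model; equivalently the Kodaira type at `p` is not `IV`, `IV*`).
Consumer (cell `bsd-addord`, item `stmt-BirchSwinnertonDyer-19679` `DeepLowerAtThreeOffKatoStratum`, stub
`stub_nonAdditive`, road (b^k) on the NON-SEMISTABLE depth-`1` rows): the class theorem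
`Summit.…KimAtThreeDeepLowerOffStratumLevelLoweringMultiStabRowsRamClass`, whose displayed existence of the
level-lowered newform is this fact's conclusion at `D = D′q` (`q` the split Tamagawa-`3` prime, `D′` the other
unramified multiplicative primes). The squarefree sibling is the special case `Squarefree N` (no additive
place; the Kodaira clause is then void).

## What is packaged, and why every clause is in print

For an elliptic curve `E/ℚ` (globally minimal model `W₀`, conductor `N = M₀·D` with `9 ∤ N`, `D` squarefree and
prime to `M₀`) with `ρ̄ = ρ̄_{E,3} : G_ℚ → GL₂(𝔽₃)` SURJECTIVE, `3 ∣ ord_r(Δ_E)` for every prime `r ∣ D`,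
`3 ∤ ord_p(Δ_E)` for every prime `p ∥ M₀` (`p² ∤ M₀`), `p ≠ 3`, `3 ∤ ord_3(Δ_E)` if `3 ∣ M₀`, and `3 ∤ #Φ_p(𝔽̄_p)`
at every place `p` of ADDITIVE reduction:

1. (Multiplicative primes, Tate curve — as in the siblings.) Every `r ∣ D` is `r ∥ N` (`D` squarefree, prime to
   `M₀`), hence multiplicative, and `ρ̄` is unramified at `r ≠ 3` (finite at `r = 3`) iff `3 ∣ ord_r(Δ_E)`
   [cite: Stevens1997OverviewFLT, Thm. (2.11)] [cite: DarmonDiamondTaylor1995, Prop. 2.12 (c), (d)]; every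
   `p ∥ M₀`, `p ≠ 3` is multiplicative with `ρ̄` RAMIFIED, so the exponent of `p` in `N(ρ̄)` is `1 = f_p(E)`; a
   `3 ∥ M₀` is multiplicative with `ρ̄|_{G_3}` not finite (`δ(ρ̄) = 1`), and `3 ∤ M₀` means `3` good (`δ = 0`) or
   `3 ∣ D` (finite, `δ = 0`) [cite: Edixhoven1997, §1 (1.6), §2 (after Prop. 2.1)].
2. (THE NEW CLAUSE: additive primes.) Let `p² ∣ M₀`, so `E` is additive at `p` and `p ≠ 3`. Serre's exponent is
   `m_p(ρ̄) = dim(E[3]/E[3]^{I_p}) + ∫₀^∞ codim E[3]^{I_p^u} du` [cite: DarmonDiamondTaylor1995, §2.1 (p. 54)]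
   and the exponent of the conductor of `E` is `f_p(E) = ε_p + δ_p` with `ε_p = dim(V₃E/V₃E^{I_p}) = 2`
   (additive reduction) and `δ_p = Σ_{i ≥ 1} (g_i/g_0) dim_{𝔽₃}(E[3]/E[3]^{G_i})`, the wild part, which MAY be
   computed with the prime `ℓ = 3 ≠ p` [cite: SilvermanATAEC1994, §IV.10 Definition (p. 380) and Thm. 10.2 (a)]
   — the same integral. Hence `m_p(ρ̄) = f_p(E) − dim E[3]^{I_p}` (this is also Darmon–Diamond–Taylor's
   Lemma 2.7, `N(ρ) = N(ρ̄)·∏ p^{dim ρ̄^{I_p} − dim ρ^{I_p}}`, with Remark 2.14: the conductor of `ρ_{E,3}|_{G_p}`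
   is `f_p(E)`, and `V₃E^{I_p} = 0` at an additive `p`) [cite: DarmonDiamondTaylor1995, Lemma 2.7 and Remark 2.14].
   Finally `E[3]^{I_p} = E(ℚ_p^{nr})[3] = 0` when `3 ∤ #Φ_p(𝔽̄_p)`: by Kodaira–Néron the index
   `[E(ℚ_p^{nr}) : E₀(ℚ_p^{nr})] = #Φ_p(𝔽̄_p)` is prime to `3` and `E₀(ℚ_p^{nr})` has no `3`-torsion at an
   additive place `p ≠ 3` (formal group pro-`p`, `Ẽ_ns(𝔽̄_p) = 𝔾_a`) [cite: SilvermanATAEC1994, Cor. IV.9.2 (d) with Table 4.1]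
   [cite: SilvermanAEC2009, Thm. VII.6.1] — in the tree this is
   `Summit.BirchSwinnertonDyer.Rank1Residual.GaloisImage.InertiaDivisible.localPoints_eq_zero_of_absInertia_fixed_of_not_dvd_componentGroupOrder`.
   So `m_p(ρ̄) = f_p(E)`: the additive part of `N` is kept entire, and `N(ρ̄)·3^{δ(ρ̄)} = M₀` exactly as in
   the squarefree sibling. (Without the clause — Kodaira type `IV` or `IV*`, `#Φ_p(𝔽̄_p) = 3` — `E[3]^{I_p}`
   is a line and the optimal level DROPS to `p^{f_p − 1}`; the statement below does not speak about that case.)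
3. `ρ̄` is absolutely irreducible, modular (from `f_E ∈ S₂(Γ₀(N))`) and absolutely irreducible on `G_{ℚ(√−3)}`
   (image `⊇ SL₂(𝔽₃)`). DARMON–DIAMOND–TAYLOR'S THEOREM 3.15 (`ℓ = 3` allowed under exactly this proviso; no
   hypothesis on `N(ρ̄)`) [cite: DarmonDiamondTaylor1995, Thm. 3.15] (= Diamond's Thm. 6.4 / Cor. 6.5 packaging
   RIBET'S theorem [cite: Ribet1990, Thm. 1.1] with Carayol's lemma and Mazur's principle
   [cite: Diamond1995RefinedSerre, Thm. 6.4 and Cor. 6.5]): there is a weight-two NEWFORM `g` with `ρ̄ ≅ ρ̄_g`,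
   level `N_g = N(ρ̄)·3^{δ(ρ̄)} = M₀` and character of order prime to `3` — hence trivial (its reduction
   `det ρ̄ · χ̄₃⁻¹ = 1`, and prime-to-`3` roots of unity inject mod `3`): `g ∈ S₂(Γ₀(M₀))`.
4. The congruences, modulo the prime of `ℚ̄ ⊂ ℂ` over `3` singled out by `ι` (replace `g` by a conjugate): at
   `p ∤ 3N` both `a_p` are `tr ρ̄(Frob_p)`; at `p ∥ M₀`, `p ≠ 3`, and at `p = 3 ∣ M₀`, exactly as in the siblings
   (local–global compatibility at `p ∥ N_g` [cite: Carayol1986, Thm. (A)], the unique unramified quotient line of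
   the ramified `ρ̄|_{G_p}`, Diamond's Cor. 6.5 type A; [cite: Edixhoven1992, Thms. 2.5–2.6] at `3`); at the
   REMOVED primes `r ∣ D` the Tate curve gives `a_r(g) ≡ tr ρ̄(Frob_r) = a_r(E)(r + 1)`
   [cite: DarmonDiamondTaylor1995, Prop. 2.12 (b), Prop. 1.5 and (1.1.4)] (and Thm. 6.4's clause at `r = 3`);
   at an ADDITIVE `p` (`p² ∣ M₀ = N_g`) BOTH coefficients VANISH: `a_p(E) = 0` (additive reduction, (1.1.4)) and
   `a_p(g) = 0` for a newform on `Γ₀(N_g)` with `p² ∣ N_g` [cite: AtkinLehner1970, Thm. 3] — a tree theorem,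
   `Literature.NumberTheory.EllipticCurves.ModularForms.IsNewform0.cuspCoeff_eq_zero_of_sq_dvd` — so the uniform
   clause «`a_p(g) ≡ a_p(f_E)` for every prime `p ∤ D`» carries no content there.

PRINT vs. CONSUMER: nothing requested is dropped; the split/non-split type of the primes of `D` is NOT assumed.
The hypothesis-free form «a newform of level exactly `N/D`» is not a printed theorem when `ρ̄` is unramified at a
multiplicative prime outside `D` or `E[3]^{I_p} ≠ 0` at an additive `p` (non-optimal levels; Diamond–Taylor is
for `p ≥ 5`) — excluded by the `ord_p(Δ_E)` and `#Φ_p` clauses, which force `M₀ = N(ρ̄)·3^δ`.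
-- TODO(general form): every `p ≥ 5` (Diamond–Taylor: non-optimal levels as well); additive `3` (`9 ∣ N`, where
-- `k(ρ̄)` and the `3`-part of the optimal level need Kraus's table).

## References

* H. Darmon, F. Diamond, R. Taylor, *Fermat's Last Theorem*, Current Developments in Mathematics 1995,
  International Press, 1–154: §2.1 (definition of `m_p`, p. 54), Lemma 2.7 (p. 54–55), Prop. 1.5, (1.1.4),
  Prop. 2.12, Remark 2.14, Thm. 3.15 (with the definition of `δ(ρ̄)` preceding it, p. 90–91). [DarmonDiamondTaylor1995]
* F. Diamond, *The refined conjecture of Serre*, in: Elliptic Curves, Modular Forms & Fermat's Last Theorem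
  (Hong Kong 1993), International Press (1995) 22–37, Thm. 6.4, Cor. 6.5. [Diamond1995RefinedSerre]
* K. A. Ribet, *On modular representations of Gal(ℚ̄/ℚ) arising from modular forms*, Invent. Math. 100
  (1990) 431–476, Thm. 1.1. [Ribet1990]
* B. Edixhoven, *Serre's conjecture*, in: Cornell–Silverman–Stevens (eds.), Modular Forms and Fermat's Last
  Theorem (Springer 1997), §1 (1.6), §2, Thm. 3.1. [Edixhoven1997]
* B. Edixhoven, *The weight in Serre's conjectures on modular forms*, Invent. Math. 109 (1992) 563–594, Thms. 2.5–2.6.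
  [Edixhoven1992]
* G. Stevens, *An overview of the proof of Fermat's Last Theorem*, ibid., §2, Thm. (2.11). [Stevens1997OverviewFLT]
* J. H. Silverman, *Advanced Topics in the Arithmetic of Elliptic Curves*, GTM 151 (1994), §IV.9 Cor. 9.2 (d) and
  Table 4.1, §IV.10 Definition (p. 380) and Thm. 10.2. [SilvermanATAEC1994]
* J. H. Silverman, *The Arithmetic of Elliptic Curves*, 2nd ed., GTM 106 (2009), Thm. VII.6.1. [SilvermanAEC2009]
* A. O. L. Atkin, J. Lehner, *Hecke operators on `Γ₀(m)`*, Math. Ann. 185 (1970) 134–160, Thm. 3. [AtkinLehner1970]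
* H. Carayol, Ann. Sci. ÉNS 19 (1986) 409–468, Thm. (A). [Carayol1986]
-/

noncomputable section

open scoped MatrixGroups ModularForm

open CongruenceSubgroup WeierstrassCurve Literature.NumberTheory.EllipticCurves.ModularForms IsDedekindDomain

namespace Literature.NumberTheory.EllipticCurves

/-- **Level lowering at any squarefree set of multiplicative primes at once, in `Γ₀(N(ρ̄)·3^δ)`-newform
currency, `p = 3`, for a conductor with additive primes** (Ribet 1990, Thm. 1.1, in the weight-two packaging
of Darmon–Diamond–Taylor, Thm. 3.15 = Diamond 1995, Thm. 6.4 / Cor. 6.5 — `ℓ = 3` under «`ρ̄|_{G_{ℚ(√−3)}}`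
absolutely irreducible», automatic for surjective `ρ̄` — with Darmon–Diamond–Taylor's Lemma 2.7 / Silverman's
definition of the conductor for the exponent of `N(ρ̄)` at the additive primes, Carayol's conductor = level
and local–global compatibility, the Tate curve at the removed primes, and Atkin–Lehner's `a_p = 0` at
`p² ∣ N_g`; see the module docstring for the clause-by-clause derivation). For a globally minimal `W₀/ℚ`,
elliptic, with `ρ̄_{E,3}` SURJECTIVE, conductor `N = M₀·D` with `9 ∤ N`, `D` squarefree and prime to `M₀`,
`3 ∣ ord_r(Δ)` for every prime `r ∣ D` (`ρ̄` unramified, resp. finite, at the primes of `D`), such that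
`3 ∤ ord_p(Δ)` for every prime `p ∣ M₀` with `p² ∤ M₀`, `p ≠ 3`, `3 ∤ ord_3(Δ)` if `3 ∣ M₀`, and
`3 ∤ #Φ_v(𝔽̄_v)` (the component-group order of the Kodaira symbol; i.e. type not `IV`, `IV*`) at every place
`v` of additive reduction (so that `M₀ = N(ρ̄)·3^{δ(ρ̄)}` is the optimal level): for the newform
`f = D₀.f ∈ S₂(Γ₀(N))` of `W₀` and every field isomorphism `ι : ℚ̄₃ ≃+* ℂ` there is a NEWFORM
`g ∈ S₂(Γ₀(M₀))` with `a_p(g) ≡ a_p(f)` for every prime `p ∤ D` and `a_r(g) ≡ a_r(f)(r + 1)` for every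
prime `r ∣ D`, the congruences being modulo the maximal ideal of `𝒪_{ℚ̄₃}` after transport by `ι⁻¹`.
[cite: DarmonDiamondTaylor1995, Thm. 3.15, Lemma 2.7, Remark 2.14 and Prop. 2.12]
[cite: Diamond1995RefinedSerre, Thm. 6.4 and Cor. 6.5] [cite: Ribet1990, Thm. 1.1] [cite: Edixhoven1997, Thm. 3.1]
[cite: SilvermanATAEC1994, §IV.10 Definition (p. 380), Thm. 10.2 (a), Cor. IV.9.2 (d) with Table 4.1]
[cite: Stevens1997OverviewFLT, Thm. (2.11)] [cite: Carayol1986, Thm. (A)] [cite: AtkinLehner1970, Thm. 3] -/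
def ribet1990_levelLowering_gamma0_newform_at_three_general : Prop :=
  ∀ (W₀ : WeierstrassCurve ℚ) [W₀.IsElliptic] [W₀.IsGloballyMinimal],
    W₀.HasSurjectiveModNGaloisRep 3 →
    ∀ {N M₀ D : ℕ} [NeZero N] [NeZero M₀], M₀ * D = N → Squarefree D → Nat.Coprime D M₀ → ¬ 3 ^ 2 ∣ N →
      N = W₀.conductorNorm ℤ →
      (∀ r : ℕ, r.Prime → r ∣ D → (3 : ℤ) ∣ padicValRat r W₀.Δ) →
      (∀ p : ℕ, p.Prime → p ∣ M₀ → ¬ p ^ 2 ∣ M₀ → p ≠ 3 → ¬ (3 : ℤ) ∣ padicValRat p W₀.Δ) →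
      (3 ∣ M₀ → ¬ (3 : ℤ) ∣ padicValRat 3 W₀.Δ) →
      (∀ v : HeightOneSpectrum ℤ, W₀.HasAdditiveReductionAt v → ¬ 3 ∣ (W₀.kodairaSymbolAt v).componentGroupOrder) →
      ∀ (D₀ : ModularParametrizationData W₀ N) (ι : PadicAlgCl 3 ≃+* ℂ),
        ∃ g : CuspForm (Gamma0 M₀) 2, IsNewform0 g ∧
          (∀ p : ℕ, p.Prime → ¬ p ∣ D → Valued.v (ι.symm (cuspCoeff D₀.f p - cuspCoeff g p)) < 1) ∧
          (∀ r : ℕ, r.Prime → r ∣ D → Valued.v (ι.symm (cuspCoeff g r - cuspCoeff D₀.f r * (r + 1))) < 1)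

/-- Unfolding lemma (the fact is a `Prop`-valued definition; this is its statement).
[cite: DarmonDiamondTaylor1995, Thm. 3.15 and Lemma 2.7] [cite: Diamond1995RefinedSerre, Thm. 6.4 and Cor. 6.5]
[cite: Ribet1990, Thm. 1.1] -/
theorem ribet1990_levelLowering_gamma0_newform_at_three_general_iff :
    ribet1990_levelLowering_gamma0_newform_at_three_general ↔
      ∀ (W₀ : WeierstrassCurve ℚ) [W₀.IsElliptic] [W₀.IsGloballyMinimal],
        W₀.HasSurjectiveModNGaloisRep 3 →
        ∀ {N M₀ D : ℕ} [NeZero N] [NeZero M₀], M₀ * D = N → Squarefree D → Nat.Coprime D M₀ → ¬ 3 ^ 2 ∣ N →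
          N = W₀.conductorNorm ℤ →
          (∀ r : ℕ, r.Prime → r ∣ D → (3 : ℤ) ∣ padicValRat r W₀.Δ) →
          (∀ p : ℕ, p.Prime → p ∣ M₀ → ¬ p ^ 2 ∣ M₀ → p ≠ 3 → ¬ (3 : ℤ) ∣ padicValRat p W₀.Δ) →
          (3 ∣ M₀ → ¬ (3 : ℤ) ∣ padicValRat 3 W₀.Δ) →
          (∀ v : HeightOneSpectrum ℤ, W₀.HasAdditiveReductionAt v →
            ¬ 3 ∣ (W₀.kodairaSymbolAt v).componentGroupOrder) →
          ∀ (D₀ : ModularParametrizationData W₀ N) (ι : PadicAlgCl 3 ≃+* ℂ),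
            ∃ g : CuspForm (Gamma0 M₀) 2, IsNewform0 g ∧
              (∀ p : ℕ, p.Prime → ¬ p ∣ D → Valued.v (ι.symm (cuspCoeff D₀.f p - cuspCoeff g p)) < 1) ∧
              (∀ r : ℕ, r.Prime → r ∣ D → Valued.v (ι.symm (cuspCoeff g r - cuspCoeff D₀.f r * (r + 1))) < 1) :=
  Iff.rfl

end Literature.NumberTheory.EllipticCurves

end
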